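import Summits.CriticalPhenomena.PercolationContinuityZ3.Theorems.PercNearOneGluingNoHeavyLowerTailSunflowerCubicInductionBernstein
import HarnessLib

/-!
# `NoHeavyLowerTail` (stmt-CriticalPhenomena-4575) — three-point AG⁺ and SHK3⁺ for every weighted graph from the
# BERNSTEIN-good-coordinate hypothesis (companion of `…SunflowerCubicInductionBernstein.lean`)

Support file (new-inequality factory, all-graph proof seat `prim-ineq-prove-4` gen 2; `--supports
stmt-CriticalPhenomena-4575`).  No definitions, no named facts, no sorries.

* `SunflowerCubic.latticeAGPlus_of_bernsteinGood` — the finite-index-type form of `SunflowerCubic.core_bernstein`: under the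
  Bernstein-good-coordinate hypothesis (an explicit binder, see the companion file's docstring; the EXISTS-GOOD-COORDINATE
  form of `…SunflowerCubicThreePoint.lean` is refuted by the hexagon, this one is census-true), every
  three-petal sunflower of up-sets satisfies `μ(C₀)μ(C₁) + μ(C₀)μ(C₂) + μ(C₁)μ(C₂) + μ(C₀)μ(C₁)μ(C₂) ≤ μ(A) μ(B)`.
* `SunflowerCubic.threePoint_agPlus_of_bernsteinGood` — for Bernoulli bond percolation with arbitrary edge weights on a
  finite vertex type and vertices `a, b, c` (cells `abc`, `ab|c`, `ac|b`, `a|bc`, `a|b|c` as in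
  `Literature.Probability.Percolation.prodBernoulli_threePoint_strongHarris`), under the hypothesis for the edge space:
  `μ(ab|c)μ(ac|b) + μ(ab|c)μ(a|bc) + μ(ac|b)μ(a|bc) + μ(ab|c)μ(ac|b)μ(a|bc) ≤ μ(abc) μ(a|b|c)`  (AG⁺, the cubic
  strengthening of Gladkov's Cor. 4.2 conjectured by prim-ineq-prove-2; 0 violations on 41 257 629 exact three-point laws,
  ttrl2 hms census).
* `SunflowerCubic.threePoint_shk3plus_of_bernsteinGood` — with Gladkov's AG: `0 ≤ (1 + t)(q t − e₂) − e₃` (SHK3⁺, the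
  Richards–Sahi cubic of the three pairwise-disconnection events; the target of the bern4 Bernstein programme).
-/

noncomputable section

namespace Summit.CriticalPhenomena.PercolationContinuityZ3.Theorems

open MeasureTheory Literature.Probability.LatticeModels Literature.Probability.LatticeModels.StrongHarris
open Literature.Probability.Percolation

namespace SunflowerCubic

variable {ι : Type*}

/-- **Lattice AG⁺ from a Bernstein-good coordinate** (finite index type; the form used in percolation).  If every three-petal
sunflower system of cylinder events over a nonempty coordinate set has a Bernstein-good coordinate (hypothesis `hgood`, see the
module docstring), then for every core `A`, pairwise disjoint petals `C 0, C 1, C 2` disjoint from `A` with `A` and all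
`A ∪ C i` closed upwards, and `B` the complement of their union:
`μ(C₀)μ(C₁) + μ(C₀)μ(C₂) + μ(C₁)μ(C₂) + μ(C₀)μ(C₁)μ(C₂) ≤ μ(A) μ(B)`. [this file] -/
theorem latticeAGPlus_of_bernsteinGood [Finite ι] [DecidableEq ι] (p : ι → unitInterval)
    (hgood : ∀ (F : Finset ι) (A B : Set (Set ι)) (C : Fin 3 → Set (Set ι)), F.Nonempty →
      (∀ i ∈ (Finset.univ : Finset (Fin 3)), ∀ j ∈ (Finset.univ : Finset (Fin 3)), i ≠ j →
        Disjoint (C i) (C j)) →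
      (∀ i ∈ (Finset.univ : Finset (Fin 3)), Disjoint A (C i)) →
      (∀ i ∈ (Finset.univ : Finset (Fin 3)), IsUpperSet (A ∪ C i)) → IsUpperSet A →
      (∀ ω, ω ∈ B ↔ ω ∉ A ∧ ∀ i ∈ (Finset.univ : Finset (Fin 3)), ω ∉ C i) →
      DeterminedBy A (↑F : Set ι) → (∀ i ∈ (Finset.univ : Finset (Fin 3)), DeterminedBy (C i) (↑F : Set ι)) →
      ∃ e ∈ F,
        0 ≤ 2 * ((prodBernoulli p).real ((· \ {e}) ⁻¹' A) * (prodBernoulli p).real ((· \ {e}) ⁻¹' B) - ((prodBernoulli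
          p).real ((· \ {e}) ⁻¹' C 0) * (prodBernoulli p).real ((· \ {e}) ⁻¹' C 1) + (prodBernoulli p).real ((· \ {e})
          ⁻¹' C 0) * (prodBernoulli p).real ((· \ {e}) ⁻¹' C 2) + (prodBernoulli p).real ((· \ {e}) ⁻¹' C 1) *
          (prodBernoulli p).real ((· \ {e}) ⁻¹' C 2)) - (prodBernoulli p).real ((· \ {e}) ⁻¹' C 0) * (prodBernoulli
          p).real ((· \ {e}) ⁻¹' C 1) * (prodBernoulli p).real ((· \ {e}) ⁻¹' C 2)) + ((prodBernoulli p).real (insert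
          e ⁻¹' A) * (prodBernoulli p).real (insert e ⁻¹' B) - ((prodBernoulli p).real (insert e ⁻¹' C 0) *
          (prodBernoulli p).real (insert e ⁻¹' C 1) + (prodBernoulli p).real (insert e ⁻¹' C 0) * (prodBernoulli
          p).real (insert e ⁻¹' C 2) + (prodBernoulli p).real (insert e ⁻¹' C 1) * (prodBernoulli p).real (insert e
          ⁻¹' C 2)) - (prodBernoulli p).real (insert e ⁻¹' C 0) * (prodBernoulli p).real (insert e ⁻¹' C 1) *
          (prodBernoulli p).real (insert e ⁻¹' C 2)) + (((prodBernoulli p).real (((· \ {e}) ⁻¹' B) ∩ (insert e ⁻¹' A))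
          + ((prodBernoulli p).real (((· \ {e}) ⁻¹' C 0) ∩ (insert e ⁻¹' A)) + (prodBernoulli p).real (((· \ {e}) ⁻¹'
          C 1) ∩ (insert e ⁻¹' A)) + (prodBernoulli p).real (((· \ {e}) ⁻¹' C 2) ∩ (insert e ⁻¹' A)))) *
          ((prodBernoulli p).real (((· \ {e}) ⁻¹' B) ∩ (insert e ⁻¹' A)) + ((prodBernoulli p).real (((· \ {e}) ⁻¹' B)
          ∩ (insert e ⁻¹' C 0)) + (prodBernoulli p).real (((· \ {e}) ⁻¹' B) ∩ (insert e ⁻¹' C 1)) + (prodBernoulli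
          p).real (((· \ {e}) ⁻¹' B) ∩ (insert e ⁻¹' C 2)))) + ((1 + (prodBernoulli p).real ((· \ {e}) ⁻¹' C 2)) *
          (((prodBernoulli p).real (((· \ {e}) ⁻¹' B) ∩ (insert e ⁻¹' C 0)) - (prodBernoulli p).real (((· \ {e}) ⁻¹' C
          0) ∩ (insert e ⁻¹' A))) * ((prodBernoulli p).real (((· \ {e}) ⁻¹' B) ∩ (insert e ⁻¹' C 1)) - (prodBernoulli
          p).real (((· \ {e}) ⁻¹' C 1) ∩ (insert e ⁻¹' A)))) + (1 + (prodBernoulli p).real ((· \ {e}) ⁻¹' C 1)) *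
          (((prodBernoulli p).real (((· \ {e}) ⁻¹' B) ∩ (insert e ⁻¹' C 0)) - (prodBernoulli p).real (((· \ {e}) ⁻¹' C
          0) ∩ (insert e ⁻¹' A))) * ((prodBernoulli p).real (((· \ {e}) ⁻¹' B) ∩ (insert e ⁻¹' C 2)) - (prodBernoulli
          p).real (((· \ {e}) ⁻¹' C 2) ∩ (insert e ⁻¹' A)))) + (1 + (prodBernoulli p).real ((· \ {e}) ⁻¹' C 0)) *
          (((prodBernoulli p).real (((· \ {e}) ⁻¹' B) ∩ (insert e ⁻¹' C 1)) - (prodBernoulli p).real (((· \ {e}) ⁻¹' C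
          1) ∩ (insert e ⁻¹' A))) * ((prodBernoulli p).real (((· \ {e}) ⁻¹' B) ∩ (insert e ⁻¹' C 2)) - (prodBernoulli
          p).real (((· \ {e}) ⁻¹' C 2) ∩ (insert e ⁻¹' A))))) + ((prodBernoulli p).real (((· \ {e}) ⁻¹' B) ∩ (insert e
          ⁻¹' C 0)) - (prodBernoulli p).real (((· \ {e}) ⁻¹' C 0) ∩ (insert e ⁻¹' A))) * ((prodBernoulli p).real (((·
          \ {e}) ⁻¹' B) ∩ (insert e ⁻¹' C 1)) - (prodBernoulli p).real (((· \ {e}) ⁻¹' C 1) ∩ (insert e ⁻¹' A))) *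
          ((prodBernoulli p).real (((· \ {e}) ⁻¹' B) ∩ (insert e ⁻¹' C 2)) - (prodBernoulli p).real (((· \ {e}) ⁻¹' C
          2) ∩ (insert e ⁻¹' A)))) ∧
        0 ≤ ((prodBernoulli p).real ((· \ {e}) ⁻¹' A) * (prodBernoulli p).real ((· \ {e}) ⁻¹' B) - ((prodBernoulli
          p).real ((· \ {e}) ⁻¹' C 0) * (prodBernoulli p).real ((· \ {e}) ⁻¹' C 1) + (prodBernoulli p).real ((· \ {e})
          ⁻¹' C 0) * (prodBernoulli p).real ((· \ {e}) ⁻¹' C 2) + (prodBernoulli p).real ((· \ {e}) ⁻¹' C 1) *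
          (prodBernoulli p).real ((· \ {e}) ⁻¹' C 2)) - (prodBernoulli p).real ((· \ {e}) ⁻¹' C 0) * (prodBernoulli
          p).real ((· \ {e}) ⁻¹' C 1) * (prodBernoulli p).real ((· \ {e}) ⁻¹' C 2)) + 2 * ((prodBernoulli p).real
          (insert e ⁻¹' A) * (prodBernoulli p).real (insert e ⁻¹' B) - ((prodBernoulli p).real (insert e ⁻¹' C 0) *
          (prodBernoulli p).real (insert e ⁻¹' C 1) + (prodBernoulli p).real (insert e ⁻¹' C 0) * (prodBernoulli
          p).real (insert e ⁻¹' C 2) + (prodBernoulli p).real (insert e ⁻¹' C 1) * (prodBernoulli p).real (insert e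
          ⁻¹' C 2)) - (prodBernoulli p).real (insert e ⁻¹' C 0) * (prodBernoulli p).real (insert e ⁻¹' C 1) *
          (prodBernoulli p).real (insert e ⁻¹' C 2)) + (((prodBernoulli p).real (((· \ {e}) ⁻¹' B) ∩ (insert e ⁻¹' A))
          + ((prodBernoulli p).real (((· \ {e}) ⁻¹' C 0) ∩ (insert e ⁻¹' A)) + (prodBernoulli p).real (((· \ {e}) ⁻¹'
          C 1) ∩ (insert e ⁻¹' A)) + (prodBernoulli p).real (((· \ {e}) ⁻¹' C 2) ∩ (insert e ⁻¹' A)))) *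
          ((prodBernoulli p).real (((· \ {e}) ⁻¹' B) ∩ (insert e ⁻¹' A)) + ((prodBernoulli p).real (((· \ {e}) ⁻¹' B)
          ∩ (insert e ⁻¹' C 0)) + (prodBernoulli p).real (((· \ {e}) ⁻¹' B) ∩ (insert e ⁻¹' C 1)) + (prodBernoulli
          p).real (((· \ {e}) ⁻¹' B) ∩ (insert e ⁻¹' C 2)))) + ((1 + (prodBernoulli p).real (insert e ⁻¹' C 2)) *
          (((prodBernoulli p).real (((· \ {e}) ⁻¹' B) ∩ (insert e ⁻¹' C 0)) - (prodBernoulli p).real (((· \ {e}) ⁻¹' C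
          0) ∩ (insert e ⁻¹' A))) * ((prodBernoulli p).real (((· \ {e}) ⁻¹' B) ∩ (insert e ⁻¹' C 1)) - (prodBernoulli
          p).real (((· \ {e}) ⁻¹' C 1) ∩ (insert e ⁻¹' A)))) + (1 + (prodBernoulli p).real (insert e ⁻¹' C 1)) *
          (((prodBernoulli p).real (((· \ {e}) ⁻¹' B) ∩ (insert e ⁻¹' C 0)) - (prodBernoulli p).real (((· \ {e}) ⁻¹' C
          0) ∩ (insert e ⁻¹' A))) * ((prodBernoulli p).real (((· \ {e}) ⁻¹' B) ∩ (insert e ⁻¹' C 2)) - (prodBernoulli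
          p).real (((· \ {e}) ⁻¹' C 2) ∩ (insert e ⁻¹' A)))) + (1 + (prodBernoulli p).real (insert e ⁻¹' C 0)) *
          (((prodBernoulli p).real (((· \ {e}) ⁻¹' B) ∩ (insert e ⁻¹' C 1)) - (prodBernoulli p).real (((· \ {e}) ⁻¹' C
          1) ∩ (insert e ⁻¹' A))) * ((prodBernoulli p).real (((· \ {e}) ⁻¹' B) ∩ (insert e ⁻¹' C 2)) - (prodBernoulli
          p).real (((· \ {e}) ⁻¹' C 2) ∩ (insert e ⁻¹' A))))) - ((prodBernoulli p).real (((· \ {e}) ⁻¹' B) ∩ (insert e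
          ⁻¹' C 0)) - (prodBernoulli p).real (((· \ {e}) ⁻¹' C 0) ∩ (insert e ⁻¹' A))) * ((prodBernoulli p).real (((·
          \ {e}) ⁻¹' B) ∩ (insert e ⁻¹' C 1)) - (prodBernoulli p).real (((· \ {e}) ⁻¹' C 1) ∩ (insert e ⁻¹' A))) *
          ((prodBernoulli p).real (((· \ {e}) ⁻¹' B) ∩ (insert e ⁻¹' C 2)) - (prodBernoulli p).real (((· \ {e}) ⁻¹' C
          2) ∩ (insert e ⁻¹' A)))))
    {A B : Set (Set ι)} {C : Fin 3 → Set (Set ι)}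
    (hdisj : ∀ i j, i ≠ j → Disjoint (C i) (C j)) (hdisjA : ∀ i, Disjoint A (C i))
    (hup : ∀ i, IsUpperSet (A ∪ C i)) (hupA : IsUpperSet A)
    (hB : ∀ ω, ω ∈ B ↔ ω ∉ A ∧ ∀ i, ω ∉ C i) :
    (prodBernoulli p).real (C 0) * (prodBernoulli p).real (C 1) +
          (prodBernoulli p).real (C 0) * (prodBernoulli p).real (C 2) +
          (prodBernoulli p).real (C 1) * (prodBernoulli p).real (C 2) +
        (prodBernoulli p).real (C 0) * (prodBernoulli p).real (C 1) * (prodBernoulli p).real (C 2) ≤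
      (prodBernoulli p).real A * (prodBernoulli p).real B := by
  classical
  haveI := Fintype.ofFinite ι
  have hall : ∀ X : Set (Set ι), DeterminedBy X (↑(Finset.univ : Finset ι) : Set ι) := fun X => by
    rw [determinedBy_iff]; intro ω ω' h; simp only [Finset.coe_univ, Set.inter_univ] at h; rw [h]
  exact core_bernstein p hgood (Finset.univ : Finset ι).card Finset.univ rfl A B C
    (fun i _ j _ hij => hdisj i j hij) (fun i _ => hdisjA i) (fun i _ => hup i) hupA
    (fun ω => (hB ω).trans (by simp)) (hall A) (fun i _ => hall _)

/-- Transitivity of `↔` (local copy). [folklore] -/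
private theorem openConn_trans'' {V : Type*} {x y z : V} {ω : BondConfig V} (h₁ : ω ∈ openConn x y)
    (h₂ : ω ∈ openConn y z) : ω ∈ openConn x z :=
  SimpleGraph.Reachable.trans h₁ h₂

/-- Symmetry of `↔` (local copy). [folklore] -/
private theorem openConn_symm'' {V : Type*} {x y : V} {ω : BondConfig V} (h : ω ∈ openConn x y) :
    ω ∈ openConn y x :=
  SimpleGraph.Reachable.symm h

/-- **Three-point AG⁺ from a Bernstein-good coordinate.**  For Bernoulli bond percolation `μ = prodBernoulli w` on a finite
vertex type and vertices `a, b, c`, with `abc = {a↔b}∩{a↔c}`, `ab|c = {a↔b}∩{a↔c}ᶜ`, `ac|b = {a↔c}∩{a↔b}ᶜ`,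
`a|bc = {b↔c}∩{a↔b}ᶜ`, `a|b|c = {a↔b}ᶜ∩{a↔c}ᶜ∩{b↔c}ᶜ`: if the good-coordinate hypothesis holds for the edge space
(`ι = Sym2 V`, `p = w`) then
`μ(ab|c)μ(ac|b) + μ(ab|c)μ(a|bc) + μ(ac|b)μ(a|bc) + μ(ab|c)μ(ac|b)μ(a|bc) ≤ μ(abc) μ(a|b|c)`  (AG⁺, the cubic
strengthening of Gladkov's Cor. 4.2 conjectured by prim-ineq-prove-2). [this file] -/
theorem threePoint_agPlus_of_bernsteinGood {V : Type*} [Fintype V] [DecidableEq V]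
    (w : Sym2 V → unitInterval)
    (hgood : ∀ (F : Finset (Sym2 V)) (A B : Set (Set (Sym2 V))) (C : Fin 3 → Set (Set (Sym2 V))), F.Nonempty →
      (∀ i ∈ (Finset.univ : Finset (Fin 3)), ∀ j ∈ (Finset.univ : Finset (Fin 3)), i ≠ j →
        Disjoint (C i) (C j)) →
      (∀ i ∈ (Finset.univ : Finset (Fin 3)), Disjoint A (C i)) →
      (∀ i ∈ (Finset.univ : Finset (Fin 3)), IsUpperSet (A ∪ C i)) → IsUpperSet A →
      (∀ ω, ω ∈ B ↔ ω ∉ A ∧ ∀ i ∈ (Finset.univ : Finset (Fin 3)), ω ∉ C i) →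
      DeterminedBy A (↑F : Set (Sym2 V)) → (∀ i ∈ (Finset.univ : Finset (Fin 3)), DeterminedBy (C i) (↑F : Set (Sym2 V))) →
      ∃ e ∈ F,
        0 ≤ 2 * ((prodBernoulli w).real ((· \ {e}) ⁻¹' A) * (prodBernoulli w).real ((· \ {e}) ⁻¹' B) - ((prodBernoulli
          w).real ((· \ {e}) ⁻¹' C 0) * (prodBernoulli w).real ((· \ {e}) ⁻¹' C 1) + (prodBernoulli w).real ((· \ {e})
          ⁻¹' C 0) * (prodBernoulli w).real ((· \ {e}) ⁻¹' C 2) + (prodBernoulli w).real ((· \ {e}) ⁻¹' C 1) *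
          (prodBernoulli w).real ((· \ {e}) ⁻¹' C 2)) - (prodBernoulli w).real ((· \ {e}) ⁻¹' C 0) * (prodBernoulli
          w).real ((· \ {e}) ⁻¹' C 1) * (prodBernoulli w).real ((· \ {e}) ⁻¹' C 2)) + ((prodBernoulli w).real (insert
          e ⁻¹' A) * (prodBernoulli w).real (insert e ⁻¹' B) - ((prodBernoulli w).real (insert e ⁻¹' C 0) *
          (prodBernoulli w).real (insert e ⁻¹' C 1) + (prodBernoulli w).real (insert e ⁻¹' C 0) * (prodBernoulli
          w).real (insert e ⁻¹' C 2) + (prodBernoulli w).real (insert e ⁻¹' C 1) * (prodBernoulli w).real (insert e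
          ⁻¹' C 2)) - (prodBernoulli w).real (insert e ⁻¹' C 0) * (prodBernoulli w).real (insert e ⁻¹' C 1) *
          (prodBernoulli w).real (insert e ⁻¹' C 2)) + (((prodBernoulli w).real (((· \ {e}) ⁻¹' B) ∩ (insert e ⁻¹' A))
          + ((prodBernoulli w).real (((· \ {e}) ⁻¹' C 0) ∩ (insert e ⁻¹' A)) + (prodBernoulli w).real (((· \ {e}) ⁻¹'
          C 1) ∩ (insert e ⁻¹' A)) + (prodBernoulli w).real (((· \ {e}) ⁻¹' C 2) ∩ (insert e ⁻¹' A)))) *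
          ((prodBernoulli w).real (((· \ {e}) ⁻¹' B) ∩ (insert e ⁻¹' A)) + ((prodBernoulli w).real (((· \ {e}) ⁻¹' B)
          ∩ (insert e ⁻¹' C 0)) + (prodBernoulli w).real (((· \ {e}) ⁻¹' B) ∩ (insert e ⁻¹' C 1)) + (prodBernoulli
          w).real (((· \ {e}) ⁻¹' B) ∩ (insert e ⁻¹' C 2)))) + ((1 + (prodBernoulli w).real ((· \ {e}) ⁻¹' C 2)) *
          (((prodBernoulli w).real (((· \ {e}) ⁻¹' B) ∩ (insert e ⁻¹' C 0)) - (prodBernoulli w).real (((· \ {e}) ⁻¹' C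
          0) ∩ (insert e ⁻¹' A))) * ((prodBernoulli w).real (((· \ {e}) ⁻¹' B) ∩ (insert e ⁻¹' C 1)) - (prodBernoulli
          w).real (((· \ {e}) ⁻¹' C 1) ∩ (insert e ⁻¹' A)))) + (1 + (prodBernoulli w).real ((· \ {e}) ⁻¹' C 1)) *
          (((prodBernoulli w).real (((· \ {e}) ⁻¹' B) ∩ (insert e ⁻¹' C 0)) - (prodBernoulli w).real (((· \ {e}) ⁻¹' C
          0) ∩ (insert e ⁻¹' A))) * ((prodBernoulli w).real (((· \ {e}) ⁻¹' B) ∩ (insert e ⁻¹' C 2)) - (prodBernoulli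
          w).real (((· \ {e}) ⁻¹' C 2) ∩ (insert e ⁻¹' A)))) + (1 + (prodBernoulli w).real ((· \ {e}) ⁻¹' C 0)) *
          (((prodBernoulli w).real (((· \ {e}) ⁻¹' B) ∩ (insert e ⁻¹' C 1)) - (prodBernoulli w).real (((· \ {e}) ⁻¹' C
          1) ∩ (insert e ⁻¹' A))) * ((prodBernoulli w).real (((· \ {e}) ⁻¹' B) ∩ (insert e ⁻¹' C 2)) - (prodBernoulli
          w).real (((· \ {e}) ⁻¹' C 2) ∩ (insert e ⁻¹' A))))) + ((prodBernoulli w).real (((· \ {e}) ⁻¹' B) ∩ (insert e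
          ⁻¹' C 0)) - (prodBernoulli w).real (((· \ {e}) ⁻¹' C 0) ∩ (insert e ⁻¹' A))) * ((prodBernoulli w).real (((·
          \ {e}) ⁻¹' B) ∩ (insert e ⁻¹' C 1)) - (prodBernoulli w).real (((· \ {e}) ⁻¹' C 1) ∩ (insert e ⁻¹' A))) *
          ((prodBernoulli w).real (((· \ {e}) ⁻¹' B) ∩ (insert e ⁻¹' C 2)) - (prodBernoulli w).real (((· \ {e}) ⁻¹' C
          2) ∩ (insert e ⁻¹' A)))) ∧
        0 ≤ ((prodBernoulli w).real ((· \ {e}) ⁻¹' A) * (prodBernoulli w).real ((· \ {e}) ⁻¹' B) - ((prodBernoulli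
          w).real ((· \ {e}) ⁻¹' C 0) * (prodBernoulli w).real ((· \ {e}) ⁻¹' C 1) + (prodBernoulli w).real ((· \ {e})
          ⁻¹' C 0) * (prodBernoulli w).real ((· \ {e}) ⁻¹' C 2) + (prodBernoulli w).real ((· \ {e}) ⁻¹' C 1) *
          (prodBernoulli w).real ((· \ {e}) ⁻¹' C 2)) - (prodBernoulli w).real ((· \ {e}) ⁻¹' C 0) * (prodBernoulli
          w).real ((· \ {e}) ⁻¹' C 1) * (prodBernoulli w).real ((· \ {e}) ⁻¹' C 2)) + 2 * ((prodBernoulli w).real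
          (insert e ⁻¹' A) * (prodBernoulli w).real (insert e ⁻¹' B) - ((prodBernoulli w).real (insert e ⁻¹' C 0) *
          (prodBernoulli w).real (insert e ⁻¹' C 1) + (prodBernoulli w).real (insert e ⁻¹' C 0) * (prodBernoulli
          w).real (insert e ⁻¹' C 2) + (prodBernoulli w).real (insert e ⁻¹' C 1) * (prodBernoulli w).real (insert e
          ⁻¹' C 2)) - (prodBernoulli w).real (insert e ⁻¹' C 0) * (prodBernoulli w).real (insert e ⁻¹' C 1) *
          (prodBernoulli w).real (insert e ⁻¹' C 2)) + (((prodBernoulli w).real (((· \ {e}) ⁻¹' B) ∩ (insert e ⁻¹' A))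
          + ((prodBernoulli w).real (((· \ {e}) ⁻¹' C 0) ∩ (insert e ⁻¹' A)) + (prodBernoulli w).real (((· \ {e}) ⁻¹'
          C 1) ∩ (insert e ⁻¹' A)) + (prodBernoulli w).real (((· \ {e}) ⁻¹' C 2) ∩ (insert e ⁻¹' A)))) *
          ((prodBernoulli w).real (((· \ {e}) ⁻¹' B) ∩ (insert e ⁻¹' A)) + ((prodBernoulli w).real (((· \ {e}) ⁻¹' B)
          ∩ (insert e ⁻¹' C 0)) + (prodBernoulli w).real (((· \ {e}) ⁻¹' B) ∩ (insert e ⁻¹' C 1)) + (prodBernoulli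
          w).real (((· \ {e}) ⁻¹' B) ∩ (insert e ⁻¹' C 2)))) + ((1 + (prodBernoulli w).real (insert e ⁻¹' C 2)) *
          (((prodBernoulli w).real (((· \ {e}) ⁻¹' B) ∩ (insert e ⁻¹' C 0)) - (prodBernoulli w).real (((· \ {e}) ⁻¹' C
          0) ∩ (insert e ⁻¹' A))) * ((prodBernoulli w).real (((· \ {e}) ⁻¹' B) ∩ (insert e ⁻¹' C 1)) - (prodBernoulli
          w).real (((· \ {e}) ⁻¹' C 1) ∩ (insert e ⁻¹' A)))) + (1 + (prodBernoulli w).real (insert e ⁻¹' C 1)) *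
          (((prodBernoulli w).real (((· \ {e}) ⁻¹' B) ∩ (insert e ⁻¹' C 0)) - (prodBernoulli w).real (((· \ {e}) ⁻¹' C
          0) ∩ (insert e ⁻¹' A))) * ((prodBernoulli w).real (((· \ {e}) ⁻¹' B) ∩ (insert e ⁻¹' C 2)) - (prodBernoulli
          w).real (((· \ {e}) ⁻¹' C 2) ∩ (insert e ⁻¹' A)))) + (1 + (prodBernoulli w).real (insert e ⁻¹' C 0)) *
          (((prodBernoulli w).real (((· \ {e}) ⁻¹' B) ∩ (insert e ⁻¹' C 1)) - (prodBernoulli w).real (((· \ {e}) ⁻¹' C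
          1) ∩ (insert e ⁻¹' A))) * ((prodBernoulli w).real (((· \ {e}) ⁻¹' B) ∩ (insert e ⁻¹' C 2)) - (prodBernoulli
          w).real (((· \ {e}) ⁻¹' C 2) ∩ (insert e ⁻¹' A))))) - ((prodBernoulli w).real (((· \ {e}) ⁻¹' B) ∩ (insert e
          ⁻¹' C 0)) - (prodBernoulli w).real (((· \ {e}) ⁻¹' C 0) ∩ (insert e ⁻¹' A))) * ((prodBernoulli w).real (((·
          \ {e}) ⁻¹' B) ∩ (insert e ⁻¹' C 1)) - (prodBernoulli w).real (((· \ {e}) ⁻¹' C 1) ∩ (insert e ⁻¹' A))) *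
          ((prodBernoulli w).real (((· \ {e}) ⁻¹' B) ∩ (insert e ⁻¹' C 2)) - (prodBernoulli w).real (((· \ {e}) ⁻¹' C
          2) ∩ (insert e ⁻¹' A)))))
    (a b c : V) :
    (prodBernoulli w).real (openConn a b ∩ (openConn a c)ᶜ) *
            (prodBernoulli w).real (openConn a c ∩ (openConn a b)ᶜ) +
          (prodBernoulli w).real (openConn a b ∩ (openConn a c)ᶜ) *
            (prodBernoulli w).real (openConn b c ∩ (openConn a b)ᶜ) +
          (prodBernoulli w).real (openConn a c ∩ (openConn a b)ᶜ) *
            (prodBernoulli w).real (openConn b c ∩ (openConn a b)ᶜ) +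
        (prodBernoulli w).real (openConn a b ∩ (openConn a c)ᶜ) *
            (prodBernoulli w).real (openConn a c ∩ (openConn a b)ᶜ) *
          (prodBernoulli w).real (openConn b c ∩ (openConn a b)ᶜ) ≤
      (prodBernoulli w).real (openConn a b ∩ openConn a c) *
        (prodBernoulli w).real ((openConn a b)ᶜ ∩ (openConn a c)ᶜ ∩ (openConn b c)ᶜ) := by
  classical
  set A : Set (BondConfig V) := openConn a b ∩ openConn a c with hA
  set C₀ : Set (BondConfig V) := openConn b c ∩ (openConn a b)ᶜ with hC₀
  set C₁ : Set (BondConfig V) := openConn a c ∩ (openConn a b)ᶜ with hC₁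
  set C₂ : Set (BondConfig V) := openConn a b ∩ (openConn a c)ᶜ with hC₂
  set Bs : Set (BondConfig V) := (openConn a b)ᶜ ∩ (openConn a c)ᶜ ∩ (openConn b c)ᶜ with hBs
  have d01 : Disjoint C₀ C₁ :=
    Set.disjoint_left.2 fun ω h0 h1 => h0.2 (openConn_trans'' h1.1 (openConn_symm'' h0.1))
  have d02 : Disjoint C₀ C₂ := Set.disjoint_left.2 fun ω h0 h2 => h0.2 h2.1
  have d12 : Disjoint C₁ C₂ := Set.disjoint_left.2 fun ω h1 h2 => h1.2 h2.1
  have dA0 : Disjoint A C₀ := Set.disjoint_left.2 fun ω hA' h0 => h0.2 hA'.1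
  have dA1 : Disjoint A C₁ := Set.disjoint_left.2 fun ω hA' h1 => h1.2 hA'.1
  have dA2 : Disjoint A C₂ := Set.disjoint_left.2 fun ω hA' h2 => h2.2 hA'.2
  have hU0 : A ∪ C₀ = openConn b c := by
    ext ω
    constructor
    · rintro (hA' | h0)
      · exact openConn_trans'' (openConn_symm'' hA'.1) hA'.2
      · exact h0.1
    · intro hbc
      by_cases hab : ω ∈ openConn a b
      · exact Or.inl ⟨hab, openConn_trans'' hab hbc⟩
      · exact Or.inr ⟨hbc, hab⟩
  have hU1 : A ∪ C₁ = openConn a c := by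
    ext ω
    constructor
    · rintro (hA' | h1)
      · exact hA'.2
      · exact h1.1
    · intro hac
      by_cases hab : ω ∈ openConn a b
      · exact Or.inl ⟨hab, hac⟩
      · exact Or.inr ⟨hac, hab⟩
  have hU2 : A ∪ C₂ = openConn a b := by
    ext ω
    constructor
    · rintro (hA' | h2)
      · exact hA'.1
      · exact h2.1
    · intro hab
      by_cases hac : ω ∈ openConn a c
      · exact Or.inl ⟨hab, hac⟩
      · exact Or.inr ⟨hab, hac⟩
  have up0 : IsUpperSet (A ∪ C₀) := by rw [hU0]; exact isUpperSet_openConn b c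
  have up1 : IsUpperSet (A ∪ C₁) := by rw [hU1]; exact isUpperSet_openConn a c
  have up2 : IsUpperSet (A ∪ C₂) := by rw [hU2]; exact isUpperSet_openConn a b
  have hAup : IsUpperSet A := (isUpperSet_openConn a b).inter (isUpperSet_openConn a c)
  let C : Fin 3 → Set (BondConfig V) := ![C₀, C₁, C₂]
  have e0 : C 0 = C₀ := rfl
  have e1 : C 1 = C₁ := rfl
  have e2 : C 2 = C₂ := rfl
  have hdisj : ∀ i j : Fin 3, i ≠ j → Disjoint (C i) (C j) := by
    intro i j hij
    fin_cases i <;> fin_cases j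
    all_goals first
      | exact (hij rfl).elim
      | exact d01 | exact d01.symm | exact d02 | exact d02.symm | exact d12 | exact d12.symm
  have hdisjA : ∀ i : Fin 3, Disjoint A (C i) := by
    intro i; fin_cases i
    · exact dA0
    · exact dA1
    · exact dA2
  have hup : ∀ i : Fin 3, IsUpperSet (A ∪ C i) := by
    intro i; fin_cases i
    · exact up0
    · exact up1
    · exact up2
  -- the outside cell is the complement of the union
  have hB : ∀ ω, ω ∈ Bs ↔ ω ∉ A ∧ ∀ i : Fin 3, ω ∉ C i := by
    intro ω
    simp only [hBs, hA, Set.mem_inter_iff, Set.mem_compl_iff]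
    constructor
    · rintro ⟨⟨hab, hac⟩, hbc⟩
      refine ⟨fun h => hab h.1, fun i => ?_⟩
      fin_cases i
      · change ω ∉ C₀; exact fun h => hbc h.1
      · change ω ∉ C₁; exact fun h => hac h.1
      · change ω ∉ C₂; exact fun h => hab h.1
    · rintro ⟨hnA, hnC⟩
      have h0 : ω ∉ C₀ := hnC 0
      have h1 : ω ∉ C₁ := hnC 1
      have h2 : ω ∉ C₂ := hnC 2
      simp only [hC₀, hC₁, hC₂, Set.mem_inter_iff, Set.mem_compl_iff, not_and, not_not] at h0 h1 h2
      by_cases hab : ω ∈ openConn a b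
      · by_cases hac : ω ∈ openConn a c
        · exact absurd ⟨hab, hac⟩ hnA
        · exact absurd (h2 hab) hac
      · refine ⟨⟨hab, fun hac => hab (h1 hac)⟩, fun hbc => hab (h0 hbc)⟩
  have key := latticeAGPlus_of_bernsteinGood w hgood hdisj hdisjA hup hAup hB
  simp only [e0, e1, e2] at key
  linarith [key]

/-- **Three-point SHK3⁺ from a Bernstein-good coordinate.**  Under the hypothesis of `threePoint_agPlus_of_bernsteinGood`,
with `t = μ(abc)`, `q = μ(a|b|c)`, `e₂, e₃` the elementary symmetric functions of `(μ(a|bc), μ(ac|b), μ(ab|c))`: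
`0 ≤ (1 + t)(q t − e₂) − e₃` — the Richards–Sahi cubic of the three pairwise-disconnection events (SHK3⁺ = AG⁺ + t·AG,
AG being Gladkov's `prodBernoulli_threePoint_strongHarris`). [this file] -/
theorem threePoint_shk3plus_of_bernsteinGood {V : Type*} [Fintype V] [DecidableEq V]
    (w : Sym2 V → unitInterval)
    (hgood : ∀ (F : Finset (Sym2 V)) (A B : Set (Set (Sym2 V))) (C : Fin 3 → Set (Set (Sym2 V))), F.Nonempty →
      (∀ i ∈ (Finset.univ : Finset (Fin 3)), ∀ j ∈ (Finset.univ : Finset (Fin 3)), i ≠ j →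
        Disjoint (C i) (C j)) →
      (∀ i ∈ (Finset.univ : Finset (Fin 3)), Disjoint A (C i)) →
      (∀ i ∈ (Finset.univ : Finset (Fin 3)), IsUpperSet (A ∪ C i)) → IsUpperSet A →
      (∀ ω, ω ∈ B ↔ ω ∉ A ∧ ∀ i ∈ (Finset.univ : Finset (Fin 3)), ω ∉ C i) →
      DeterminedBy A (↑F : Set (Sym2 V)) → (∀ i ∈ (Finset.univ : Finset (Fin 3)), DeterminedBy (C i) (↑F : Set (Sym2 V))) →
      ∃ e ∈ F,
        0 ≤ 2 * ((prodBernoulli w).real ((· \ {e}) ⁻¹' A) * (prodBernoulli w).real ((· \ {e}) ⁻¹' B) - ((prodBernoulli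
          w).real ((· \ {e}) ⁻¹' C 0) * (prodBernoulli w).real ((· \ {e}) ⁻¹' C 1) + (prodBernoulli w).real ((· \ {e})
          ⁻¹' C 0) * (prodBernoulli w).real ((· \ {e}) ⁻¹' C 2) + (prodBernoulli w).real ((· \ {e}) ⁻¹' C 1) *
          (prodBernoulli w).real ((· \ {e}) ⁻¹' C 2)) - (prodBernoulli w).real ((· \ {e}) ⁻¹' C 0) * (prodBernoulli
          w).real ((· \ {e}) ⁻¹' C 1) * (prodBernoulli w).real ((· \ {e}) ⁻¹' C 2)) + ((prodBernoulli w).real (insert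
          e ⁻¹' A) * (prodBernoulli w).real (insert e ⁻¹' B) - ((prodBernoulli w).real (insert e ⁻¹' C 0) *
          (prodBernoulli w).real (insert e ⁻¹' C 1) + (prodBernoulli w).real (insert e ⁻¹' C 0) * (prodBernoulli
          w).real (insert e ⁻¹' C 2) + (prodBernoulli w).real (insert e ⁻¹' C 1) * (prodBernoulli w).real (insert e
          ⁻¹' C 2)) - (prodBernoulli w).real (insert e ⁻¹' C 0) * (prodBernoulli w).real (insert e ⁻¹' C 1) *
          (prodBernoulli w).real (insert e ⁻¹' C 2)) + (((prodBernoulli w).real (((· \ {e}) ⁻¹' B) ∩ (insert e ⁻¹' A))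
          + ((prodBernoulli w).real (((· \ {e}) ⁻¹' C 0) ∩ (insert e ⁻¹' A)) + (prodBernoulli w).real (((· \ {e}) ⁻¹'
          C 1) ∩ (insert e ⁻¹' A)) + (prodBernoulli w).real (((· \ {e}) ⁻¹' C 2) ∩ (insert e ⁻¹' A)))) *
          ((prodBernoulli w).real (((· \ {e}) ⁻¹' B) ∩ (insert e ⁻¹' A)) + ((prodBernoulli w).real (((· \ {e}) ⁻¹' B)
          ∩ (insert e ⁻¹' C 0)) + (prodBernoulli w).real (((· \ {e}) ⁻¹' B) ∩ (insert e ⁻¹' C 1)) + (prodBernoulli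
          w).real (((· \ {e}) ⁻¹' B) ∩ (insert e ⁻¹' C 2)))) + ((1 + (prodBernoulli w).real ((· \ {e}) ⁻¹' C 2)) *
          (((prodBernoulli w).real (((· \ {e}) ⁻¹' B) ∩ (insert e ⁻¹' C 0)) - (prodBernoulli w).real (((· \ {e}) ⁻¹' C
          0) ∩ (insert e ⁻¹' A))) * ((prodBernoulli w).real (((· \ {e}) ⁻¹' B) ∩ (insert e ⁻¹' C 1)) - (prodBernoulli
          w).real (((· \ {e}) ⁻¹' C 1) ∩ (insert e ⁻¹' A)))) + (1 + (prodBernoulli w).real ((· \ {e}) ⁻¹' C 1)) *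
          (((prodBernoulli w).real (((· \ {e}) ⁻¹' B) ∩ (insert e ⁻¹' C 0)) - (prodBernoulli w).real (((· \ {e}) ⁻¹' C
          0) ∩ (insert e ⁻¹' A))) * ((prodBernoulli w).real (((· \ {e}) ⁻¹' B) ∩ (insert e ⁻¹' C 2)) - (prodBernoulli
          w).real (((· \ {e}) ⁻¹' C 2) ∩ (insert e ⁻¹' A)))) + (1 + (prodBernoulli w).real ((· \ {e}) ⁻¹' C 0)) *
          (((prodBernoulli w).real (((· \ {e}) ⁻¹' B) ∩ (insert e ⁻¹' C 1)) - (prodBernoulli w).real (((· \ {e}) ⁻¹' C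
          1) ∩ (insert e ⁻¹' A))) * ((prodBernoulli w).real (((· \ {e}) ⁻¹' B) ∩ (insert e ⁻¹' C 2)) - (prodBernoulli
          w).real (((· \ {e}) ⁻¹' C 2) ∩ (insert e ⁻¹' A))))) + ((prodBernoulli w).real (((· \ {e}) ⁻¹' B) ∩ (insert e
          ⁻¹' C 0)) - (prodBernoulli w).real (((· \ {e}) ⁻¹' C 0) ∩ (insert e ⁻¹' A))) * ((prodBernoulli w).real (((·
          \ {e}) ⁻¹' B) ∩ (insert e ⁻¹' C 1)) - (prodBernoulli w).real (((· \ {e}) ⁻¹' C 1) ∩ (insert e ⁻¹' A))) *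
          ((prodBernoulli w).real (((· \ {e}) ⁻¹' B) ∩ (insert e ⁻¹' C 2)) - (prodBernoulli w).real (((· \ {e}) ⁻¹' C
          2) ∩ (insert e ⁻¹' A)))) ∧
        0 ≤ ((prodBernoulli w).real ((· \ {e}) ⁻¹' A) * (prodBernoulli w).real ((· \ {e}) ⁻¹' B) - ((prodBernoulli
          w).real ((· \ {e}) ⁻¹' C 0) * (prodBernoulli w).real ((· \ {e}) ⁻¹' C 1) + (prodBernoulli w).real ((· \ {e})
          ⁻¹' C 0) * (prodBernoulli w).real ((· \ {e}) ⁻¹' C 2) + (prodBernoulli w).real ((· \ {e}) ⁻¹' C 1) *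
          (prodBernoulli w).real ((· \ {e}) ⁻¹' C 2)) - (prodBernoulli w).real ((· \ {e}) ⁻¹' C 0) * (prodBernoulli
          w).real ((· \ {e}) ⁻¹' C 1) * (prodBernoulli w).real ((· \ {e}) ⁻¹' C 2)) + 2 * ((prodBernoulli w).real
          (insert e ⁻¹' A) * (prodBernoulli w).real (insert e ⁻¹' B) - ((prodBernoulli w).real (insert e ⁻¹' C 0) *
          (prodBernoulli w).real (insert e ⁻¹' C 1) + (prodBernoulli w).real (insert e ⁻¹' C 0) * (prodBernoulli
          w).real (insert e ⁻¹' C 2) + (prodBernoulli w).real (insert e ⁻¹' C 1) * (prodBernoulli w).real (insert e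
          ⁻¹' C 2)) - (prodBernoulli w).real (insert e ⁻¹' C 0) * (prodBernoulli w).real (insert e ⁻¹' C 1) *
          (prodBernoulli w).real (insert e ⁻¹' C 2)) + (((prodBernoulli w).real (((· \ {e}) ⁻¹' B) ∩ (insert e ⁻¹' A))
          + ((prodBernoulli w).real (((· \ {e}) ⁻¹' C 0) ∩ (insert e ⁻¹' A)) + (prodBernoulli w).real (((· \ {e}) ⁻¹'
          C 1) ∩ (insert e ⁻¹' A)) + (prodBernoulli w).real (((· \ {e}) ⁻¹' C 2) ∩ (insert e ⁻¹' A)))) *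
          ((prodBernoulli w).real (((· \ {e}) ⁻¹' B) ∩ (insert e ⁻¹' A)) + ((prodBernoulli w).real (((· \ {e}) ⁻¹' B)
          ∩ (insert e ⁻¹' C 0)) + (prodBernoulli w).real (((· \ {e}) ⁻¹' B) ∩ (insert e ⁻¹' C 1)) + (prodBernoulli
          w).real (((· \ {e}) ⁻¹' B) ∩ (insert e ⁻¹' C 2)))) + ((1 + (prodBernoulli w).real (insert e ⁻¹' C 2)) *
          (((prodBernoulli w).real (((· \ {e}) ⁻¹' B) ∩ (insert e ⁻¹' C 0)) - (prodBernoulli w).real (((· \ {e}) ⁻¹' C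
          0) ∩ (insert e ⁻¹' A))) * ((prodBernoulli w).real (((· \ {e}) ⁻¹' B) ∩ (insert e ⁻¹' C 1)) - (prodBernoulli
          w).real (((· \ {e}) ⁻¹' C 1) ∩ (insert e ⁻¹' A)))) + (1 + (prodBernoulli w).real (insert e ⁻¹' C 1)) *
          (((prodBernoulli w).real (((· \ {e}) ⁻¹' B) ∩ (insert e ⁻¹' C 0)) - (prodBernoulli w).real (((· \ {e}) ⁻¹' C
          0) ∩ (insert e ⁻¹' A))) * ((prodBernoulli w).real (((· \ {e}) ⁻¹' B) ∩ (insert e ⁻¹' C 2)) - (prodBernoulli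
          w).real (((· \ {e}) ⁻¹' C 2) ∩ (insert e ⁻¹' A)))) + (1 + (prodBernoulli w).real (insert e ⁻¹' C 0)) *
          (((prodBernoulli w).real (((· \ {e}) ⁻¹' B) ∩ (insert e ⁻¹' C 1)) - (prodBernoulli w).real (((· \ {e}) ⁻¹' C
          1) ∩ (insert e ⁻¹' A))) * ((prodBernoulli w).real (((· \ {e}) ⁻¹' B) ∩ (insert e ⁻¹' C 2)) - (prodBernoulli
          w).real (((· \ {e}) ⁻¹' C 2) ∩ (insert e ⁻¹' A))))) - ((prodBernoulli w).real (((· \ {e}) ⁻¹' B) ∩ (insert e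
          ⁻¹' C 0)) - (prodBernoulli w).real (((· \ {e}) ⁻¹' C 0) ∩ (insert e ⁻¹' A))) * ((prodBernoulli w).real (((·
          \ {e}) ⁻¹' B) ∩ (insert e ⁻¹' C 1)) - (prodBernoulli w).real (((· \ {e}) ⁻¹' C 1) ∩ (insert e ⁻¹' A))) *
          ((prodBernoulli w).real (((· \ {e}) ⁻¹' B) ∩ (insert e ⁻¹' C 2)) - (prodBernoulli w).real (((· \ {e}) ⁻¹' C
          2) ∩ (insert e ⁻¹' A)))))
    (a b c : V) :
    0 ≤ (1 + (prodBernoulli w).real (openConn a b ∩ openConn a c)) *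
          ((prodBernoulli w).real ((openConn a b)ᶜ ∩ (openConn a c)ᶜ ∩ (openConn b c)ᶜ) *
              (prodBernoulli w).real (openConn a b ∩ openConn a c) -
            ((prodBernoulli w).real (openConn a b ∩ (openConn a c)ᶜ) *
                (prodBernoulli w).real (openConn a c ∩ (openConn a b)ᶜ) +
              (prodBernoulli w).real (openConn a b ∩ (openConn a c)ᶜ) *
                (prodBernoulli w).real (openConn b c ∩ (openConn a b)ᶜ) +
              (prodBernoulli w).real (openConn a c ∩ (openConn a b)ᶜ) *
                (prodBernoulli w).real (openConn b c ∩ (openConn a b)ᶜ))) -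
        (prodBernoulli w).real (openConn a b ∩ (openConn a c)ᶜ) *
            (prodBernoulli w).real (openConn a c ∩ (openConn a b)ᶜ) *
          (prodBernoulli w).real (openConn b c ∩ (openConn a b)ᶜ) := by
  have hAGp := threePoint_agPlus_of_bernsteinGood w hgood a b c
  have hAG := prodBernoulli_threePoint_strongHarris w a b c
  exact SunflowerCubicStep.shk3plus_of_agPlus hAGp hAG measureReal_nonneg

end SunflowerCubic

end Summit.CriticalPhenomena.PercolationContinuityZ3.Theorems
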